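import Summits.BirchSwinnertonDyer.Rank1Residual.Additive.KatoDescentGlobalKummerTamagawa
import Summits.BirchSwinnertonDyer.Rank1Residual.Additive.KatoDescentIntegralH1TorsionFree
import Summits.BirchSwinnertonDyer.BirchSwinnertonDyer.Theorems.KatoDescentPotSupersingularIntegralH1LayerZeroTop
import HarnessLib

set_option autoImplicit false

/-!
# The INTEGRAL Kummer classes `y(P) = p^c • κ_∞(P) ∈ A = H¹(ℤ[1/p], T_pW)` (bottom-layer spelling) and THE INDEX
# `[A : ℤ_p·y(P)] = #ker φ · p^{c + v(log_ω P) − v₀}` through the Kummer-logarithm functional — brick (b) of the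
# COUNT-EC⁰ lane (seat `bsd-cm-prr-ty1` g10, cell `bsd-cm`; theorems only: no definition, no named fact, no instance,
# no `sorry`)

Part 16 of the seat's kernel cut of stub 3 `stub_rankOneCountReadingKato` of the Kato–Perrin-Riou skeletons v4 (cruxes
stmt-BirchSwinnertonDyer-19945 / -19223; = cell bsd-potss's held input 27322). The residual display COUNT-EC⁰ («`v_p #(J.H2)_Γ
+ v₀ = v_p #Ш[p^∞] + v_p Tam + 2·v_p log_ω P`», Part 11) measures `A = integralH1 (tateRep W p) p (κ.layerSubgroup 0)` through
the `ℤ_p`-linear Kummer-logarithm functional `φ` (`φ(A) = p^{v₀}ℤ_p`, Parts 8–10). Part 15 (`KatoDescentGlobalKummerTamagawa`)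
gave a uniform `c` with `p^c • κ_∞(P) ∈ H¹(ℤ[1/p], T_pW)` (`⊤`-spelling) for every `P ∈ W(ℚ)`. THIS FILE reads these
classes in `A` and evaluates Part 10's index formula on them:

* §1 `padicLogLocal_map_nsmul`, `padicLogLocal_map_ne_zero` — `log_ω(n • P) = n · log_ω(P)`; a rational point of
  infinite order has `log_ω(P) ≠ 0` (`log_ω = padicLog` on `E(ℚ_p)`, whose kernel is torsion, AEC IV.6.4; `W(ℚ) → W(ℚ_p)`
  is injective).
* §2 **`exists_integralH1_kummerTate`** — `∃ c, ∃ y : W(ℚ) →+ A` additive with, for every `P`,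
  `ofTop(red_{p^k}(layerZeroToTop (y P))) = κ_{p^k}(p^c • P)` for all `k` (i.e. `layerZeroToTop (y P) = p^c • κ_∞(P)`) and
  `HasLocPKummerLog W p (layerZeroToTop (y P)) (p^c · log_ω P)` (Part 15 transported along potss's
  `exists_integralH1LayerZeroEquivTop`).
* §3 for ANY Kummer-logarithm functional `φ` on `A` (`HasLocPKummerLog (φ x)` for all `x`, e.g. Part 8's
  `exists_kummerLog_linearMap`): `kummerLog_integralH1_kummerTate_eq` **`φ(y P) = p^c · log_ω P`**, `…_ne_zero` (for `P` of
  infinite order), `valuation_…` (`= c + v(log_ω P)`), **`natCard_quotient_span_integralH1_kummerTate_eq`: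
  `#(A / ℤ_p·y(P)) = #ker φ · p^{c + v(log_ω P) − v₀}`** (Part 10's `natCard_quotient_span_singleton_eq` at `y = y(P)`),
  `le_add_valuation_padicLogLocal` (`v₀ ≤ c + v(log_ω P)`).
* §4 `exists_kummerLog_ne_zero_of_not_isOfFinAddOrder` / `exists_kummerLog_range_eq_span_zpow` — **`φ ≠ 0` on `A` and
  `φ(A) = p^{v₀}ℤ_p` for some `v₀`, as soon as `W(ℚ)` has a point of infinite order** (PACKAGE-FREE and `Ш`-FREE: Part 10's
  `exists_kummerLog_range_eq` took the non-zero value from the (α)-class of a descent package); on the rows (`rank 1`,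
  `Ш[p^∞]` finite, `p ∤ #W(ℚ)_tors`, where `#ker φ = 1` by Part 11): `natCard_quotient_span_integralH1_kummerTate_eq_pow`
  **`#(A / ℤ_p·y(P)) = p^{c + v(log_ω P) − v₀}`**, `finite_quotient_span_integralH1_kummerTate`.
* §5 **`rank_integralH1_eq_one`** — on the rows `rank_{ℤ_p} A = 1` ((R1-a): Part 8's `≤ 1` + torsion-freeness (Part 11) +
  the non-zero integral Kummer class of §4).

WHY (potss memo KMC-DESCENT-MEMO §4): (R1-a) «`𝔥 := H¹(ℤ[1/p], j_*T) = p^a·ℤ_p κ(P)`» and (R1-e) «`[𝔥 : z] = #H²(ℤ[1/p], T)`,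
`z = λ·κ(P)`» are statements about indices of lines in `𝔥 = A`; this file supplies the index of the line of the integral Kummer
class in closed form (`a ≤ c`; `a` cancels in (R1-f)). What remains for COUNT-EC⁰ is brick (c): the compact Poitou–Tate count
of `#(J.H2)_Γ = #H²(ℤ[1/p], T_pW)` ((R1-b)–(R1-d)).

HONEST LABEL: theorems only; no stub or item is closed; nothing is registered; nothing is asserted on 19945 / 19223;
Kato's Main Conjecture and Perrin-Riou's conjecture are not touched; BSD is not proved for any curve.

References: [Kato2004Asterisque] §13.8 (p. 228), §14.1 (p. 235), Thm. 14.5 and the definition of `[M : z]` (pp. 236–237),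
§14.9 (14.9.3) (p. 240), §14.14 (14.14.1) (p. 243), §14.18 (p. 244); [BlochKato1990] Def. 3.10, Ex. 3.11;
[SilvermanAEC2009] IV.6.4, VII.6.3; [SerreLocalFields1979] I §3 Prop. 5; [PerrinRiou1993AIF] §3.3.
-/

noncomputable section

open scoped Classical NumberField ContRepresentation

open WeierstrassCurve Field IsDedekindDomain NumberField CategoryTheory Literature.NumberTheory.EllipticCurves
  Literature.NumberTheory.EllipticCurves.Kato2004 Literature.NumberTheory.GaloisRepresentations
  Literature.NumberTheory.EllipticCurves.Kato2004.EulerSystemValues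
  Summit.BirchSwinnertonDyer.BirchSwinnertonDyer.Theorems.CongruentShaFreeCutKatoKummerLogTorsion
  Summit.BirchSwinnertonDyer.BirchSwinnertonDyer.Theorems.IntegralH1LayerZeroTop
  Summit.BirchSwinnertonDyer.Rank1Residual.Additive.GlobalKummer
open WeierstrassCurve (geomPoints geomTorsion galH1Torsion)

namespace Summit.BirchSwinnertonDyer.Rank1Residual.Additive.LocPKummer

variable (W : WeierstrassCurve ℚ) [W.IsElliptic] [W.IsGloballyMinimal] (p : ℕ) [Fact p.Prime]
  [ContinuousSMul ℤ_[p] (W.tateModule p)]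

/-! ## §1 `log_ω` is additive on rational points; a point of infinite order has `log_ω ≠ 0` -/

omit [ContinuousSMul ℤ_[p] (W.tateModule p)] in
/-- **`log_ω(n • P) = n · log_ω(P)`** for `P ∈ W(ℚ)` read in `W(ℚ_p)` (`log_ω = padicLogLocal` is the tree's `ℤ_p`-linear
`padicLog` on `E(ℚ_p)`, `padicLogLocal_eq_padicLog`). [cite: SilvermanAEC2009, IV.6.4 and VII.6.3] -/
theorem padicLogLocal_map_nsmul (n : ℕ) (P : W.toAffine.Point) :
    padicLogLocal W p (Affine.Point.map (W' := W.toAffine) (S := ℚ) (Algebra.ofId ℚ ℚ_[p]) (n • P)) =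
      (n : ℚ_[p]) * padicLogLocal W p (Affine.Point.map (W' := W.toAffine) (S := ℚ) (Algebra.ofId ℚ ℚ_[p]) P) := by
  -- `W(ℚ) → W(ℚ_p)` is additive (the point groups of `W` and of `W.baseChange ℚ` agree definitionally)
  have h := map_nsmul (Affine.Point.map (W' := W.toAffine) (S := ℚ) (Algebra.ofId ℚ ℚ_[p])) n P
  calc padicLogLocal W p (Affine.Point.map (W' := W.toAffine) (S := ℚ) (Algebra.ofId ℚ ℚ_[p]) (n • P))
      = padicLogLocal W p (n • Affine.Point.map (W' := W.toAffine) (S := ℚ) (Algebra.ofId ℚ ℚ_[p]) P) := by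
        exact congrArg (padicLogLocal W p) h
    _ = (n : ℚ_[p]) * padicLogLocal W p (Affine.Point.map (W' := W.toAffine) (S := ℚ) (Algebra.ofId ℚ ℚ_[p]) P) := by
        rw [padicLogLocal_eq_padicLog, padicLogLocal_eq_padicLog, map_nsmul, nsmul_eq_mul]

omit [ContinuousSMul ℤ_[p] (W.tateModule p)] in
/-- **A rational point of infinite order has `log_ω(P) ≠ 0`**: `log_ω(Q) = 0` forces `Q ∈ E(ℚ_p)` torsion
(`isOfFinAddOrder_of_padicLogLocal_eq_zero`, AEC IV.6.4), and `W(ℚ) → W(ℚ_p)` is an injective homomorphism.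
[cite: SilvermanAEC2009, IV.6.4 and VII.6.3] -/
theorem padicLogLocal_map_ne_zero {P : W.toAffine.Point} (hP : ¬ IsOfFinAddOrder P) :
    padicLogLocal W p (Affine.Point.map (W' := W.toAffine) (S := ℚ) (Algebra.ofId ℚ ℚ_[p]) P) ≠ 0 := by
  intro h
  apply hP
  have hfin := isOfFinAddOrder_of_padicLogLocal_eq_zero W p h
  obtain ⟨n, hn, hnP⟩ := hfin.exists_nsmul_eq_zero
  refine isOfFinAddOrder_iff_nsmul_eq_zero.mpr ⟨n, hn, ?_⟩
  apply Affine.Point.map_injective (W' := W.toAffine) (Algebra.ofId ℚ ℚ_[p])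
  exact ((map_nsmul (Affine.Point.map (W' := W.toAffine) (S := ℚ) (Algebra.ofId ℚ ℚ_[p])) n P).trans hnP).trans
    (map_zero _).symm

/-! ## §2 The integral Kummer classes `y(P) = p^c • κ_∞(P)` read in `A = integralH1 … (κ.layerSubgroup 0)` -/

variable (κ : ZpExtension ℚ p)

/-- **THE INTEGRAL KUMMER MAP INTO `A`**: there are `c : ℕ` and an additive `y : W(ℚ) →+ A`,
`A = integralH1 (tateRep W p) p (κ.layerSubgroup 0)` (the bottom-layer spelling of `H¹(ℤ[1/p], T_pW)` used by the
descent packages), such that for every `P ∈ W(ℚ)`: `layerZeroToTop (y P)` has `ofTop(red_{p^k}(·)) = κ_{p^k}(p^c • P)` for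
all `k` (it IS `p^c • κ_∞(P)`), and `HasLocPKummerLog W p (layerZeroToTop (y P)) (p^c · log_ω P)`. (Part 15
`exists_pow_smul_kummerTate_mem_integralH1_hasLocPKummerLog` transported along potss's
`exists_integralH1LayerZeroEquivTop`; `log_ω(p^c • P) = p^c log_ω P`.)
[cite: Kato2004Asterisque, §14.1 (p. 235), §14.14 (14.14.1) (p. 243) and §14.18 (p. 244)] [cite: BlochKato1990, Ex. 3.11] -/
theorem exists_integralH1_kummerTate :
    ∃ (c : ℕ) (y : W.toAffine.Point →+ integralH1 (tateRep W p) p (κ.layerSubgroup 0)),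
      ∀ P : W.toAffine.Point,
        (∀ k : ℕ,
          (ofTopSubgroup (W.torsionGaloisModule ((p : ℤ) ^ k)).toTopRep 1).hom
              (reduceH1Pk W p k ⊤
                (layerZeroToTop W p κ (y P : H1 (tateRep W p) (κ.layerSubgroup 0)))) =
            kummerMapTorsion W ((p : ℤ) ^ k)
              (fun R ↦ zsmul_geomPoints_surjective_holds W
                (pow_ne_zero k (Int.natCast_ne_zero.mpr (Fact.out : p.Prime).ne_zero)) R) (p ^ c • P)) ∧
        HasLocPKummerLog W p (layerZeroToTop W p κ (y P : H1 (tateRep W p) (κ.layerSubgroup 0)))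
          ((p : ℚ_[p]) ^ c *
            padicLogLocal W p (Affine.Point.map (W' := W.toAffine) (S := ℚ) (Algebra.ofId ℚ ℚ_[p]) P)) := by
  obtain ⟨c, κi, hκ, hP⟩ := exists_pow_smul_kummerTate_mem_integralH1_hasLocPKummerLog W p
  obtain ⟨e, he⟩ := exists_integralH1LayerZeroEquivTop W p κ
  -- `P ↦ ⟨p^c • κ_∞ P, _⟩ ∈ integralH1 … ⊤`, additively
  let g : W.toAffine.Point →+ integralH1 (tateRep W p) p ⊤ :=
    { toFun := fun P ↦ ⟨p ^ c • κi P, (hP P).1⟩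
      map_zero' := Subtype.ext (by simp only [map_zero, nsmul_zero]; rfl)
      map_add' := fun P Q ↦ Subtype.ext (by simp only [map_add, nsmul_add]; rfl) }
  refine ⟨c, (e.symm : integralH1 (tateRep W p) p ⊤ →ₗ[ℤ_[p]] integralH1 (tateRep W p) p (κ.layerSubgroup 0)).toAddMonoidHom.comp g,
    fun P ↦ ?_⟩
  have hlift : layerZeroToTop W p κ
      (((e.symm : integralH1 (tateRep W p) p ⊤ →ₗ[ℤ_[p]] integralH1 (tateRep W p) p (κ.layerSubgroup 0)).toAddMonoidHom.comp g P :
        integralH1 (tateRep W p) p (κ.layerSubgroup 0)) : H1 (tateRep W p) (κ.layerSubgroup 0)) = p ^ c • κi P := by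
    have h1 := he (e.symm (g P))
    rw [LinearEquiv.apply_symm_apply] at h1
    exact h1.symm
  refine ⟨fun k ↦ ?_, ?_⟩
  · rw [hlift, (hP P).2.1, hκ]
  · have h3 := (hP P).2.2
    rw [padicLogLocal_map_nsmul, Nat.cast_pow] at h3
    rw [hlift]
    exact h3


/-! ## §3 The Kummer-log functional on `y(P)` and the index `[A : ℤ_p·y(P)]` -/

variable {κ}

/-- **`φ(y P) = p^c · log_ω(P)`** for every Kummer-logarithm functional `φ` on `A` (`HasLocPKummerLog (φ x)` for all
`x ∈ A`, e.g. Part 8's `exists_kummerLog_linearMap`) and every `y` as in `exists_integralH1_kummerTate`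
(uniqueness of the Kummer logarithm, `HasLocPKummerLog.unique`). [cite: BlochKato1990, Def. 3.10 and Ex. 3.11]
[cite: Kato2004Asterisque, §14.9 (14.9.3) (p. 240)] -/
theorem kummerLog_integralH1_kummerTate_eq
    (φ : integralH1 (tateRep W p) p (κ.layerSubgroup 0) →ₗ[ℤ_[p]] ℚ_[p])
    (hφ : ∀ x : integralH1 (tateRep W p) p (κ.layerSubgroup 0),
      HasLocPKummerLog W p (layerZeroToTop W p κ (x : H1 (tateRep W p) (κ.layerSubgroup 0))) (φ x))
    {c : ℕ} {y : W.toAffine.Point →+ integralH1 (tateRep W p) p (κ.layerSubgroup 0)}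
    (hy : ∀ P : W.toAffine.Point,
      HasLocPKummerLog W p (layerZeroToTop W p κ (y P : H1 (tateRep W p) (κ.layerSubgroup 0)))
        ((p : ℚ_[p]) ^ c * padicLogLocal W p (Affine.Point.map (W' := W.toAffine) (S := ℚ) (Algebra.ofId ℚ ℚ_[p]) P)))
    (P : W.toAffine.Point) :
    φ (y P) = (p : ℚ_[p]) ^ c *
      padicLogLocal W p (Affine.Point.map (W' := W.toAffine) (S := ℚ) (Algebra.ofId ℚ ℚ_[p]) P) :=
  ContraCount.HasLocPKummerLog.unique W p (hφ (y P)) (hy P)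

/-- **`φ(y P) ≠ 0` for `P` of infinite order** (`p^c ≠ 0`, `log_ω P ≠ 0`). [cite: BlochKato1990, Ex. 3.11]
[cite: SilvermanAEC2009, IV.6.4] -/
theorem kummerLog_integralH1_kummerTate_ne_zero
    (φ : integralH1 (tateRep W p) p (κ.layerSubgroup 0) →ₗ[ℤ_[p]] ℚ_[p])
    (hφ : ∀ x : integralH1 (tateRep W p) p (κ.layerSubgroup 0),
      HasLocPKummerLog W p (layerZeroToTop W p κ (x : H1 (tateRep W p) (κ.layerSubgroup 0))) (φ x))
    {c : ℕ} {y : W.toAffine.Point →+ integralH1 (tateRep W p) p (κ.layerSubgroup 0)}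
    (hy : ∀ P : W.toAffine.Point,
      HasLocPKummerLog W p (layerZeroToTop W p κ (y P : H1 (tateRep W p) (κ.layerSubgroup 0)))
        ((p : ℚ_[p]) ^ c * padicLogLocal W p (Affine.Point.map (W' := W.toAffine) (S := ℚ) (Algebra.ofId ℚ ℚ_[p]) P)))
    {P : W.toAffine.Point} (hP : ¬ IsOfFinAddOrder P) : φ (y P) ≠ 0 := by
  rw [kummerLog_integralH1_kummerTate_eq W p φ hφ hy P]
  exact mul_ne_zero (pow_ne_zero _ (Nat.cast_ne_zero.mpr (Fact.out : p.Prime).ne_zero))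
    (padicLogLocal_map_ne_zero W p hP)

/-- **`v(φ(y P)) = c + v(log_ω P)`** for `P` of infinite order. [cite: BlochKato1990, Ex. 3.11] [cite: Kato2004Asterisque, §14.18 (p. 244)] -/
theorem valuation_kummerLog_integralH1_kummerTate
    (φ : integralH1 (tateRep W p) p (κ.layerSubgroup 0) →ₗ[ℤ_[p]] ℚ_[p])
    (hφ : ∀ x : integralH1 (tateRep W p) p (κ.layerSubgroup 0),
      HasLocPKummerLog W p (layerZeroToTop W p κ (x : H1 (tateRep W p) (κ.layerSubgroup 0))) (φ x))
    {c : ℕ} {y : W.toAffine.Point →+ integralH1 (tateRep W p) p (κ.layerSubgroup 0)}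
    (hy : ∀ P : W.toAffine.Point,
      HasLocPKummerLog W p (layerZeroToTop W p κ (y P : H1 (tateRep W p) (κ.layerSubgroup 0)))
        ((p : ℚ_[p]) ^ c * padicLogLocal W p (Affine.Point.map (W' := W.toAffine) (S := ℚ) (Algebra.ofId ℚ ℚ_[p]) P)))
    {P : W.toAffine.Point} (hP : ¬ IsOfFinAddOrder P) :
    (φ (y P)).valuation =
      (c : ℤ) + (padicLogLocal W p (Affine.Point.map (W' := W.toAffine) (S := ℚ) (Algebra.ofId ℚ ℚ_[p]) P)).valuation := by
  rw [kummerLog_integralH1_kummerTate_eq W p φ hφ hy P,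
    Padic.valuation_mul (pow_ne_zero _ (Nat.cast_ne_zero.mpr (Fact.out : p.Prime).ne_zero))
      (padicLogLocal_map_ne_zero W p hP),
    Padic.valuation_pow, Padic.valuation_p, mul_one]

/-- **THE INDEX OF THE INTEGRAL KUMMER CLASS: `#(A / ℤ_p·y(P)) = #ker φ · p^{c + v(log_ω P) − v₀}`** for `P ∈ W(ℚ)` of
infinite order, `φ` a Kummer-logarithm functional on `A = integralH1 (tateRep W p) p (κ.layerSubgroup 0)` with
`φ(A) = p^{v₀}ℤ_p`, and `y(P) = p^c • κ_∞(P)` read in `A` (`exists_integralH1_kummerTate`) — Part 10's index formula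
`natCard_quotient_span_singleton_eq` at `y = y(P)`, with `v(φ(y P)) = c + v(log_ω P)`. This is brick (b) of the
COUNT-EC⁰ lane: the term `[𝔥 : ℤ_p·p^c κ(P)]` of the rank-one Poitou–Tate count (potss memo KMC-DESCENT-MEMO §4 (R1-a),
(R1-e): `𝔥 = H¹(ℤ[1/p], T_pW)`; Kato §14.18, proof of Thm. 14.16 (2)). [cite: Kato2004Asterisque, Thm. 14.5, definition of
`[M : z]` (pp. 236–237), and §14.18 (p. 244)] [cite: BlochKato1990, Ex. 3.11] -/
theorem natCard_quotient_span_integralH1_kummerTate_eq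
    (φ : integralH1 (tateRep W p) p (κ.layerSubgroup 0) →ₗ[ℤ_[p]] ℚ_[p])
    (hφ : ∀ x : integralH1 (tateRep W p) p (κ.layerSubgroup 0),
      HasLocPKummerLog W p (layerZeroToTop W p κ (x : H1 (tateRep W p) (κ.layerSubgroup 0))) (φ x))
    {v₀ : ℤ} (hv₀ : LinearMap.range φ = Submodule.span ℤ_[p] {((p : ℚ_[p]) ^ v₀)})
    {c : ℕ} {y : W.toAffine.Point →+ integralH1 (tateRep W p) p (κ.layerSubgroup 0)}
    (hy : ∀ P : W.toAffine.Point,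
      HasLocPKummerLog W p (layerZeroToTop W p κ (y P : H1 (tateRep W p) (κ.layerSubgroup 0)))
        ((p : ℚ_[p]) ^ c * padicLogLocal W p (Affine.Point.map (W' := W.toAffine) (S := ℚ) (Algebra.ofId ℚ ℚ_[p]) P)))
    {P : W.toAffine.Point} (hP : ¬ IsOfFinAddOrder P) :
    Nat.card (integralH1 (tateRep W p) p (κ.layerSubgroup 0) ⧸ (ℤ_[p] ∙ y P)) =
      Nat.card (LinearMap.ker φ) *
        p ^ ((c : ℤ) + (padicLogLocal W p (Affine.Point.map (W' := W.toAffine) (S := ℚ) (Algebra.ofId ℚ ℚ_[p]) P)).valuation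
          - v₀).toNat := by
  rw [natCard_quotient_span_singleton_eq φ (kummerLog_integralH1_kummerTate_ne_zero W p φ hφ hy hP) hv₀,
    valuation_kummerLog_integralH1_kummerTate W p φ hφ hy hP]

/-- **`v₀ ≤ c + v(log_ω P)`**: the normalisation `φ(A) = p^{v₀}ℤ_p` divides the Kummer logarithm `p^c log_ω P` of the
integral Kummer class of every `P` of infinite order (`le_valuation_of_range_eq`). [cite: Kato2004Asterisque, §14.18 (p. 244)] -/
theorem le_add_valuation_padicLogLocal
    (φ : integralH1 (tateRep W p) p (κ.layerSubgroup 0) →ₗ[ℤ_[p]] ℚ_[p])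
    (hφ : ∀ x : integralH1 (tateRep W p) p (κ.layerSubgroup 0),
      HasLocPKummerLog W p (layerZeroToTop W p κ (x : H1 (tateRep W p) (κ.layerSubgroup 0))) (φ x))
    {v₀ : ℤ} (hv₀ : LinearMap.range φ = Submodule.span ℤ_[p] {((p : ℚ_[p]) ^ v₀)})
    {c : ℕ} {y : W.toAffine.Point →+ integralH1 (tateRep W p) p (κ.layerSubgroup 0)}
    (hy : ∀ P : W.toAffine.Point,
      HasLocPKummerLog W p (layerZeroToTop W p κ (y P : H1 (tateRep W p) (κ.layerSubgroup 0)))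
        ((p : ℚ_[p]) ^ c * padicLogLocal W p (Affine.Point.map (W' := W.toAffine) (S := ℚ) (Algebra.ofId ℚ ℚ_[p]) P)))
    {P : W.toAffine.Point} (hP : ¬ IsOfFinAddOrder P) :
    v₀ ≤ (c : ℤ) + (padicLogLocal W p (Affine.Point.map (W' := W.toAffine) (S := ℚ) (Algebra.ofId ℚ ℚ_[p]) P)).valuation := by
  rw [← valuation_kummerLog_integralH1_kummerTate W p φ hφ hy hP]
  exact le_valuation_of_range_eq φ hv₀ (kummerLog_integralH1_kummerTate_ne_zero W p φ hφ hy hP)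

/-! ## §4 Package-free normalisation of the Kummer-log functional; the index on the rows -/

/-- **`φ ≠ 0` on `A` as soon as `W(ℚ)` has a point of infinite order** — no descent package and no finiteness of `Ш`
needed (compare Part 10's `exists_kummerLog_range_eq`, which produced a non-zero value from the (α)-class of a package):
the integral Kummer class `y(P₀)` has `φ(y P₀) = p^c log_ω P₀ ≠ 0`. [cite: Kato2004Asterisque, §14.1 (p. 235) and §14.18 (p. 244)]
[cite: BlochKato1990, Ex. 3.11] -/
theorem exists_kummerLog_ne_zero_of_not_isOfFinAddOrder (κ : ZpExtension ℚ p)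
    (φ : integralH1 (tateRep W p) p (κ.layerSubgroup 0) →ₗ[ℤ_[p]] ℚ_[p])
    (hφ : ∀ x : integralH1 (tateRep W p) p (κ.layerSubgroup 0),
      HasLocPKummerLog W p (layerZeroToTop W p κ (x : H1 (tateRep W p) (κ.layerSubgroup 0))) (φ x))
    {P₀ : W.toAffine.Point} (hP₀ : ¬ IsOfFinAddOrder P₀) :
    ∃ b : integralH1 (tateRep W p) p (κ.layerSubgroup 0), φ b ≠ 0 := by
  obtain ⟨c, y, hy⟩ := exists_integralH1_kummerTate W p κ
  exact ⟨y P₀, kummerLog_integralH1_kummerTate_ne_zero W p φ hφ (fun P ↦ (hy P).2) hP₀⟩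

/-- **`φ(A) = p^{v₀}ℤ_p` for some `v₀ ∈ ℤ`** as soon as `W(ℚ)` has a point of infinite order (`A` is finitely generated
over `ℤ_p`, `module_finite_integralH1_layerZero`; Part 10's `exists_range_eq_span_zpow`). [cite: Kato2004Asterisque, §14.18 (p. 244)]
[cite: SerreLocalFields1979, Ch. I §3, Prop. 5] -/
theorem exists_kummerLog_range_eq_span_zpow (κ : ZpExtension ℚ p)
    (φ : integralH1 (tateRep W p) p (κ.layerSubgroup 0) →ₗ[ℤ_[p]] ℚ_[p])
    (hφ : ∀ x : integralH1 (tateRep W p) p (κ.layerSubgroup 0),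
      HasLocPKummerLog W p (layerZeroToTop W p κ (x : H1 (tateRep W p) (κ.layerSubgroup 0))) (φ x))
    {P₀ : W.toAffine.Point} (hP₀ : ¬ IsOfFinAddOrder P₀) :
    ∃ v₀ : ℤ, LinearMap.range φ = Submodule.span ℤ_[p] {((p : ℚ_[p]) ^ v₀)} := by
  haveI := module_finite_integralH1_layerZero W p κ
  obtain ⟨b, hb⟩ := exists_kummerLog_ne_zero_of_not_isOfFinAddOrder W p κ φ hφ hP₀
  exact exists_range_eq_span_zpow φ hb

/-- **ON THE ROWS (`rank W(ℚ) = 1`, `Ш[p^∞]` finite, `p ∤ #W(ℚ)_tors`): `#(A / ℤ_p·y(P)) = p^{c + v(log_ω P) − v₀}`** — Part 11's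
`kummerLog_injective_of_not_dvd_torsionOrder` gives `#ker φ = 1`. [cite: Kato2004Asterisque, Thm. 14.5 (pp. 236–237), §13.8 (p. 228)
and §14.18 (p. 244)] [cite: BlochKato1990, Ex. 3.11] -/
theorem natCard_quotient_span_integralH1_kummerTate_eq_pow (hrank : W.mordellWeilRank = 1)
    (hsha : Finite (AddCommGroup.primaryComponent W.sha p)) (htors : ¬ p ∣ W.torsionOrder)
    (φ : integralH1 (tateRep W p) p (κ.layerSubgroup 0) →ₗ[ℤ_[p]] ℚ_[p])
    (hφ : ∀ x : integralH1 (tateRep W p) p (κ.layerSubgroup 0),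
      HasLocPKummerLog W p (layerZeroToTop W p κ (x : H1 (tateRep W p) (κ.layerSubgroup 0))) (φ x))
    {v₀ : ℤ} (hv₀ : LinearMap.range φ = Submodule.span ℤ_[p] {((p : ℚ_[p]) ^ v₀)})
    {c : ℕ} {y : W.toAffine.Point →+ integralH1 (tateRep W p) p (κ.layerSubgroup 0)}
    (hy : ∀ P : W.toAffine.Point,
      HasLocPKummerLog W p (layerZeroToTop W p κ (y P : H1 (tateRep W p) (κ.layerSubgroup 0)))
        ((p : ℚ_[p]) ^ c * padicLogLocal W p (Affine.Point.map (W' := W.toAffine) (S := ℚ) (Algebra.ofId ℚ ℚ_[p]) P)))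
    {P : W.toAffine.Point} (hP : ¬ IsOfFinAddOrder P) :
    Nat.card (integralH1 (tateRep W p) p (κ.layerSubgroup 0) ⧸ (ℤ_[p] ∙ y P)) =
      p ^ ((c : ℤ) + (padicLogLocal W p (Affine.Point.map (W' := W.toAffine) (S := ℚ) (Algebra.ofId ℚ ℚ_[p]) P)).valuation
        - v₀).toNat := by
  rw [natCard_quotient_span_integralH1_kummerTate_eq W p φ hφ hv₀ hy hP,
    kummerLog_injective_of_not_dvd_torsionOrder W p κ hrank hsha htors φ hφ, one_mul]


/-- **On the rows, `A / ℤ_p·y(P)` is FINITE** for every `P` of infinite order (its cardinality is a power of `p`).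
[cite: Kato2004Asterisque, Thm. 14.5 (pp. 236–237) and §14.18 (p. 244)] -/
theorem finite_quotient_span_integralH1_kummerTate (hrank : W.mordellWeilRank = 1)
    (hsha : Finite (AddCommGroup.primaryComponent W.sha p)) (htors : ¬ p ∣ W.torsionOrder)
    (φ : integralH1 (tateRep W p) p (κ.layerSubgroup 0) →ₗ[ℤ_[p]] ℚ_[p])
    (hφ : ∀ x : integralH1 (tateRep W p) p (κ.layerSubgroup 0),
      HasLocPKummerLog W p (layerZeroToTop W p κ (x : H1 (tateRep W p) (κ.layerSubgroup 0))) (φ x))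
    {v₀ : ℤ} (hv₀ : LinearMap.range φ = Submodule.span ℤ_[p] {((p : ℚ_[p]) ^ v₀)})
    {c : ℕ} {y : W.toAffine.Point →+ integralH1 (tateRep W p) p (κ.layerSubgroup 0)}
    (hy : ∀ P : W.toAffine.Point,
      HasLocPKummerLog W p (layerZeroToTop W p κ (y P : H1 (tateRep W p) (κ.layerSubgroup 0)))
        ((p : ℚ_[p]) ^ c * padicLogLocal W p (Affine.Point.map (W' := W.toAffine) (S := ℚ) (Algebra.ofId ℚ ℚ_[p]) P)))
    {P : W.toAffine.Point} (hP : ¬ IsOfFinAddOrder P) :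
    Finite (integralH1 (tateRep W p) p (κ.layerSubgroup 0) ⧸ (ℤ_[p] ∙ y P)) := by
  apply Nat.finite_of_card_ne_zero
  rw [natCard_quotient_span_integralH1_kummerTate_eq_pow W p hrank hsha htors φ hφ hv₀ hy hP]
  exact pow_ne_zero _ (Fact.out : p.Prime).ne_zero


/-! ## §5 (R1-a): on the rows `A = H¹(ℤ[1/p], T_pW)` has `ℤ_p`-rank EXACTLY one -/

/-- **(R1-a) `rank_{ℤ_p} A = 1` on the rows** (`rank W(ℚ) = 1`, `Ш[p^∞]` finite, `p ∤ #W(ℚ)_tors`): `≤ 1` is Part 8's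
`rank_integralH1_le_one` (Kato's `loc_p`-kernel torsion in rank one); `≥ 1` because `A` is torsion free (Part 11,
`noZeroSMulDivisors_H1_layerZero_of_not_dvd_torsionOrder`) and NON-ZERO — it contains the integral Kummer class `y(P₀)` of a
point of infinite order, on which the Kummer-log functional does not vanish (§4). With Part 11 this is potss's (R1-a)
«`H¹(G_S,T) ≅ ℤ_p`, `H¹(ℤ[1/p],T)_tors = 0`» in the tree's currency. [cite: Kato2004Asterisque, §13.8 (p. 228), §14.1 (p. 235)
and §14.18 (p. 244)] [cite: BlochKato1990, Ex. 3.11] -/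
theorem rank_integralH1_eq_one (hrank : W.mordellWeilRank = 1)
    (hsha : Finite (AddCommGroup.primaryComponent W.sha p)) (htors : ¬ p ∣ W.torsionOrder) :
    Module.rank ℤ_[p] (integralH1 (tateRep W p) p (κ.layerSubgroup 0)) = 1 := by
  refine le_antisymm (rank_integralH1_le_one W p κ hrank hsha) ?_
  haveI := noZeroSMulDivisors_H1_layerZero_of_not_dvd_torsionOrder W p κ htors
  haveI : NoZeroSMulDivisors ℤ_[p] (integralH1 (tateRep W p) p (κ.layerSubgroup 0)) :=
    ⟨fun {a x} h ↦ by
      have h' : a • (x : H1 (tateRep W p) (κ.layerSubgroup 0)) = 0 := congrArg Subtype.val h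
      rcases smul_eq_zero.mp h' with ha | hx
      · exact Or.inl ha
      · exact Or.inr (Subtype.ext hx)⟩
  obtain ⟨P₀, hP₀⟩ := WeierstrassCurve.exists_not_isOfFinAddOrder_of_mordellWeilRank_ne_zero W
    (by rw [hrank]; exact one_ne_zero)
  obtain ⟨φ, hφ⟩ := exists_kummerLog_linearMap W p κ hP₀
  obtain ⟨b, hb⟩ := exists_kummerLog_ne_zero_of_not_isOfFinAddOrder W p κ φ hφ hP₀
  haveI : Nontrivial (integralH1 (tateRep W p) p (κ.layerSubgroup 0)) :=
    ⟨⟨b, 0, fun h ↦ hb (by rw [h, map_zero])⟩⟩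
  exact Cardinal.one_le_iff_pos.mpr (rank_pos (R := ℤ_[p]))

end Summit.BirchSwinnertonDyer.Rank1Residual.Additive.LocPKummer

end
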